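import Summits.ResolutionOfSingularities.ResolutionOfSingularities.Theorems.FrobeniusClosingPatchingRelPerfectMonomialSumStratumStep
import HarnessLib

/-!
# Crux `PatchingRelPerfect` (stmt-ResolutionOfSingularities-16161), chain w52 — M2-strong, SCHEME DICTIONARY
# part 1: POSITIONAL bookkeeping of boundaries and exponent lists (towards the polyhedra-game interface)

[OURS · L1 W5.2 · TargetsF3 (m) M2-strong, background line «stub-4 keeps the SCHEME dictionary,
res-type-075 the COMBINATORIAL half» (plan-1 g7 RULING 06:34:44Z)] The combinatorial half (Hironaka's
PERMISSIBLE polyhedra game, global form) sees a chart-free state: divisors indexed by their POSITION in the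
boundary list, one exponent vector per member of the family, the family of «strata» (position sets whose
divisors have a common point), moves = blow-up of a stratum `J` with every member transformed by
`x ↦ (x, |x_J| − 1)` (= `transformExp · π T 1`, positionally).  This file PROVES the scheme-side
positional facts the dictionary needs, independent of the exact shape of the game's typed block:

* `nthSheaf Es k`, `nthExp A k` (position accessors) and their behaviour under `map`/`++`/`transformExp`
  (`nthSheaf_transformBoundary_lt/_eq`, `nthExp_transformExp_lt/_eq`);
* `weightAt_eq_sum_nthExp` — the weight of `A` at `x` is the sum of the exponents at the positions whose
  divisor passes through `x`; `weightAt_eq_zero_of_forall_nthExp_eq_zero`;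
* sequel `…MonomialPositionStrata.lean`: pointed-distinct boundaries, position strata, admissibility of the
  new strata.

Fact-free; nothing here is a statement of the manuscript under review.

## References

* J. Kollár, *Lectures on Resolution of Singularities* (2007), (3.111) Step 3. [Kollar2007]
* R. Goward, *A simple algorithm for principalization of monomial ideals*, Trans. AMS 357 (2005).
  [Goward2005]
-/

-- `Summit.<Summit>.<Sub>.Theorems` with `Sub = Summit` (single-conjunct summit, D-0017)
set_option linter.dupNamespace false

noncomputable section

open CategoryTheory AlgebraicGeometry TopologicalSpace IsLocalRing
open Literature.AlgebraicGeometry.Resolution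

namespace Summit.ResolutionOfSingularities.ResolutionOfSingularities.Theorems

namespace MonomialCleanup

universe u

/-! ## Position accessors -/

section Accessors

variable {X : Scheme.{u}}

/-- The divisor at position `k` of a boundary list (the unit ideal sheaf past the end). [folklore] -/
def nthSheaf : List X.IdealSheafData → ℕ → X.IdealSheafData
  | [], _ => ⊤
  | K :: _, 0 => K
  | _ :: t, k + 1 => nthSheaf t k

/-- The exponent at position `k` of an exponent list (`0` past the end). [folklore] -/
def nthExp : List (X.IdealSheafData × ℕ) → ℕ → ℕ
  | [], _ => 0
  | p :: _, 0 => p.2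
  | _ :: t, k + 1 => nthExp t k

/-- Unfolding. [folklore] -/
@[simp] theorem nthSheaf_nil (k : ℕ) : nthSheaf ([] : List X.IdealSheafData) k = ⊤ := by cases k <;> rfl
/-- Unfolding. [folklore] -/
@[simp] theorem nthSheaf_cons_zero (K : X.IdealSheafData) (t : List X.IdealSheafData) : nthSheaf (K :: t) 0 = K := rfl
/-- Unfolding. [folklore] -/
@[simp] theorem nthSheaf_cons_succ (K : X.IdealSheafData) (t : List X.IdealSheafData) (k : ℕ) :
    nthSheaf (K :: t) (k + 1) = nthSheaf t k := rfl
/-- Unfolding. [folklore] -/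
@[simp] theorem nthExp_nil (k : ℕ) : nthExp ([] : List (X.IdealSheafData × ℕ)) k = 0 := by cases k <;> rfl
/-- Unfolding. [folklore] -/
@[simp] theorem nthExp_cons_zero (p : X.IdealSheafData × ℕ) (t : List (X.IdealSheafData × ℕ)) :
    nthExp (p :: t) 0 = p.2 := rfl
/-- Unfolding. [folklore] -/
@[simp] theorem nthExp_cons_succ (p : X.IdealSheafData × ℕ) (t : List (X.IdealSheafData × ℕ)) (k : ℕ) :
    nthExp (p :: t) (k + 1) = nthExp t k := rfl

/-- Positions past the end carry the unit ideal. [folklore] -/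
theorem nthSheaf_of_length_le {Es : List X.IdealSheafData} {k : ℕ} (hk : Es.length ≤ k) : nthSheaf Es k = ⊤ := by
  induction Es generalizing k with
  | nil => simp
  | cons K t ih =>
    cases k with
    | zero => simp at hk
    | succ k => rw [nthSheaf_cons_succ]; exact ih (by simpa using hk)

/-- Positions past the end carry exponent zero. [folklore] -/
theorem nthExp_of_length_le {A : List (X.IdealSheafData × ℕ)} {k : ℕ} (hk : A.length ≤ k) : nthExp A k = 0 := by
  induction A generalizing k with
  | nil => simp
  | cons p t ih =>
    cases k with
    | zero => simp at hk
    | succ k => rw [nthExp_cons_succ]; exact ih (by simpa using hk)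

/-- A position inside the list carries a member of the list. [folklore] -/
theorem nthSheaf_mem {Es : List X.IdealSheafData} {k : ℕ} (hk : k < Es.length) : nthSheaf Es k ∈ Es := by
  induction Es generalizing k with
  | nil => simp at hk
  | cons K t ih =>
    cases k with
    | zero => simp
    | succ k => rw [nthSheaf_cons_succ]; exact List.mem_cons_of_mem _ (ih (by simpa using hk))

/-- `nthSheaf` after `map`. [folklore] -/
theorem nthSheaf_map (Es : List X.IdealSheafData) {X' : Scheme.{u}} (f : X.IdealSheafData → X'.IdealSheafData)
    {k : ℕ} (hk : k < Es.length) : nthSheaf (Es.map f) k = f (nthSheaf Es k) := by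
  induction Es generalizing k with
  | nil => simp at hk
  | cons K t ih =>
    cases k with
    | zero => simp
    | succ k => simp only [List.map_cons, nthSheaf_cons_succ]; exact ih (by simpa using hk)

/-- `nthSheaf` of an append, left part. [folklore] -/
theorem nthSheaf_append_left (Es Fs : List X.IdealSheafData) {k : ℕ} (hk : k < Es.length) :
    nthSheaf (Es ++ Fs) k = nthSheaf Es k := by
  induction Es generalizing k with
  | nil => simp at hk
  | cons K t ih =>
    cases k with
    | zero => simp
    | succ k => simp only [List.cons_append, nthSheaf_cons_succ]; exact ih (by simpa using hk)

/-- `nthSheaf` of an append at the first position of the right part. [folklore] -/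
theorem nthSheaf_append_length (Es : List X.IdealSheafData) (F : X.IdealSheafData) (Fs : List X.IdealSheafData) :
    nthSheaf (Es ++ F :: Fs) Es.length = F := by
  induction Es with
  | nil => simp
  | cons K t ih => simp only [List.cons_append, List.length_cons, nthSheaf_cons_succ]; exact ih

/-- `nthExp` after relabelling the sheaves. [folklore] -/
theorem nthExp_map_fst (A : List (X.IdealSheafData × ℕ)) {X' : Scheme.{u}} (f : X.IdealSheafData → X'.IdealSheafData)
    (k : ℕ) : nthExp (A.map fun p => (f p.1, p.2)) k = nthExp A k := by
  induction A generalizing k with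
  | nil => simp
  | cons p t ih =>
    cases k with
    | zero => simp
    | succ k => simp only [List.map_cons, nthExp_cons_succ]; exact ih k

/-- `nthExp` of an append, left part. [folklore] -/
theorem nthExp_append_left (A B : List (X.IdealSheafData × ℕ)) {k : ℕ} (hk : k < A.length) :
    nthExp (A ++ B) k = nthExp A k := by
  induction A generalizing k with
  | nil => simp at hk
  | cons p t ih =>
    cases k with
    | zero => simp
    | succ k => simp only [List.cons_append, nthExp_cons_succ]; exact ih (by simpa using hk)

/-- `nthExp` of an append at the first position of the right part. [folklore] -/
theorem nthExp_append_length (A : List (X.IdealSheafData × ℕ)) (p : X.IdealSheafData × ℕ)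
    (B : List (X.IdealSheafData × ℕ)) : nthExp (A ++ p :: B) A.length = p.2 := by
  induction A with
  | nil => simp
  | cons q t ih => simp only [List.cons_append, List.length_cons, nthExp_cons_succ]; exact ih

/-- The length of an exponent list is the length of its boundary. [folklore] -/
theorem length_boundaryOf (A : List (X.IdealSheafData × ℕ)) : (boundaryOf A).length = A.length :=
  List.length_map _

end Accessors

/-! ## Positional transform -/

section Transform

variable {X X' : Scheme.{u}} {π : X' ⟶ X} {T : Finset X.IdealSheafData} {m : ℕ}

/-- **The transformed boundary** `Es.map strict ++ [F]`, positionally: old positions carry the strict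
transforms … [folklore] -/
theorem nthSheaf_transformBoundary_lt (Es : List X.IdealSheafData) {k : ℕ} (hk : k < Es.length) :
    nthSheaf (Es.map (strictTransformIdeal π (T.sup id)) ++ [(T.sup id).comap π]) k =
      strictTransformIdeal π (T.sup id) (nthSheaf Es k) := by
  rw [nthSheaf_append_left _ _ (by simpa using hk), nthSheaf_map Es _ hk]

/-- … and the new last position carries the exceptional divisor. [folklore] -/
theorem nthSheaf_transformBoundary_eq (Es : List X.IdealSheafData) :
    nthSheaf (Es.map (strictTransformIdeal π (T.sup id)) ++ [(T.sup id).comap π]) Es.length =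
      (T.sup id).comap π := by
  have h := nthSheaf_append_length (Es.map (strictTransformIdeal π (T.sup id))) ((T.sup id).comap π) []
  rwa [List.length_map] at h

/-- **The transformed exponent list**, positionally: old positions keep their exponents … [folklore] -/
theorem nthExp_transformExp_lt (A : List (X.IdealSheafData × ℕ)) {k : ℕ} (hk : k < A.length) :
    nthExp (transformExp A π T m) k = nthExp A k := by
  rw [transformExp, nthExp_append_left _ _ (by simpa using hk), nthExp_map_fst]

/-- … and the new last position carries `∑_T a − m`. [folklore] -/
theorem nthExp_transformExp_eq (A : List (X.IdealSheafData × ℕ)) :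
    nthExp (transformExp A π T m) A.length = weightOf A T - m := by
  rw [transformExp]
  have h := nthExp_append_length (A.map fun p => (strictTransformIdeal π (T.sup id) p.1, p.2))
    ((T.sup id).comap π, weightOf A T - m) []
  rwa [List.length_map] at h

/-- The transformed exponent list has one more position. [folklore] -/
theorem length_transformExp (A : List (X.IdealSheafData × ℕ)) : (transformExp A π T m).length = A.length + 1 := by
  simp [transformExp]

end Transform

/-! ## Weights, positionally -/

section Weights

variable {X : Scheme.{u}}

open Classical in
/-- **The weight at a point is the sum of the exponents at the positions whose divisor passes through
it.** [folklore] -/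
theorem weightAt_eq_sum_nthExp (A : List (X.IdealSheafData × ℕ)) (x : X) :
    weightAt A x = ∑ k ∈ Finset.range A.length,
      (if x ∈ (nthSheaf (boundaryOf A) k).support then nthExp A k else 0) := by
  induction A with
  | nil => simp
  | cons p t ih =>
    rw [weightAt_cons, ih, List.length_cons, Finset.sum_range_succ']
    simp only [boundaryOf, List.map_cons, nthSheaf_cons_succ, nthExp_cons_succ, nthSheaf_cons_zero,
      nthExp_cons_zero]
    rw [add_comm]

/-- If every position whose divisor passes through `x` has exponent zero, the weight at `x` vanishes.
[folklore] -/
theorem weightAt_eq_zero_of_forall_nthExp_eq_zero (A : List (X.IdealSheafData × ℕ)) (x : X)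
    (h : ∀ k < A.length, x ∈ (nthSheaf (boundaryOf A) k).support → nthExp A k = 0) : weightAt A x = 0 := by
  classical
  rw [weightAt_eq_sum_nthExp]
  refine Finset.sum_eq_zero fun k hk => ?_
  by_cases hx : x ∈ (nthSheaf (boundaryOf A) k).support
  · rw [if_pos hx]; exact h k (Finset.mem_range.mp hk) hx
  · rw [if_neg hx]

open Classical in
/-- **The weight of a set of divisors is the sum of the exponents at the positions carrying a member of
the set.** [folklore] -/
theorem weightOf_eq_sum_nthExp (A : List (X.IdealSheafData × ℕ)) (T : Finset X.IdealSheafData) :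
    weightOf A T = ∑ k ∈ Finset.range A.length,
      (if nthSheaf (boundaryOf A) k ∈ T then nthExp A k else 0) := by
  induction A with
  | nil => simp
  | cons p t ih =>
    rw [weightOf_cons, ih, List.length_cons, Finset.sum_range_succ']
    simp only [boundaryOf, List.map_cons, nthSheaf_cons_succ, nthExp_cons_succ, nthSheaf_cons_zero,
      nthExp_cons_zero]
    rw [add_comm]

end Weights

end MonomialCleanup

end Summit.ResolutionOfSingularities.ResolutionOfSingularities.Theorems

end
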